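import Summits.PneNP.PneNP.Theorems.ChebyshevTracialDesignLevelDominance
import Summits.PneNP.PneNP.Theorems.ChebyshevTracialDesignTightEvenProduct
import Summits.PneNP.PneNP.Theorems.ChebyshevTracialDesignJuntaVirtualPositivity
import HarnessLib

/-!
# Cell pnp-psdrank, route `ChebyshevTracialDesign`: attenuation of EVERY level kernel on EVERY even layer (ATT, all depths)

Harmonic backbone of the crux `TracialDecayExp20` (stmt-PneNP-19878), brick 12 — the kernel form of the route's stub (ATT)
"`σ_k(c)² ≤ (O(k)/n)^{k/2}` on the design levels", now for ALL layers `2 ≤ 2κ' ≤ t−1` and all levels `c = 2m+1 ≤ t`, where the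
tree so far had it at the tight level only (bricks 5e–5i, closed form) and, uniformly in the level, by the dipole-hit bound of
eng g7 (`…DipoleHitRatio`, decreasing only for `κ' ≲ n/350` — the deep modes were open, p1 ROUND-3 (D1)/J5).
For `n` even, `t = 2c+1`, `2t ≤ n`, `κ' ≤ c`, `m ≤ c`, the Gram class functions `κ₁` (tight incidence `#cr(U,M) = 1`) and `κ_m`
(level incidence `#cr(U,M) = 2m+1`) on the `t`-sets satisfy
* `kernelEigen_level_mul_eq` (PROPORTIONALITY): `λ_{2κ'}(κ_m)·σ̃_{2κ'}(c)² = λ_{2κ'}(κ₁)·σ̃_{2κ'}(c−m)²` — every level kernel is,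
  layer by layer, a scalar multiple of the tight one, because the level column sums of a harmonic layer all factor through the same
  matching-side functional `Π_p` (bricks 7/10) ["rank one in the level", MEMO-7 (1f)];
* `kernelEigen_level_eq_zero_of_odd`: odd layers vanish for every level;
* `kernelEigen_level_le` (ATT): `λ_{2κ'}(κ_m) ≤ λ₀(κ_m) · (1+ρ)^{2κ'} · Π_{i<κ'} (2i+1)/(n−2i)`,
  `ρ = 2m(2m+1)/(4(c−m+1)(n/2−c−m))` — tight dominance (brick 11) × the tight product bound (brick 5i) × `λ₀ = d_R d_C` with the
  explicit column counts `T(n/2; 2m+1, c−m)`. For the design levels `c ≤ 4√n + 3` and balanced `t`, `(1+ρ)^{2κ'} = e^{O(1)}`: the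
  normalised singular values of EVERY level relation decay like `(2κ'/n)^{κ'/2}` down to the deepest layer — what the degree-truncation
  tail (lit `sum_sq_gram_highPart_le`) of the r = 1 rung and of the psd reduction (ATT ⇒ VIRT) consumes.
[cite: Rothvoss2017, §2 (PDF p. 6)] [cite: GodsilMeagher2015, §15.2 (perfect matching scheme)] [cite: BrouwerHaemers2012, Prop. 4.3.2 (PDF p. 83)]
Stature: support/instrument. WHAT THIS IS NOT: not virtual positivity, nothing on psd rank, no P-vs-NP content. Supports stmt-PneNP-19878.
-/

set_option linter.dupNamespace false -- `Summit.PneNP.PneNP.…`: summit = sub-problem (D-0017)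

noncomputable section

namespace Summit.PneNP.PneNP.Theorems.ChebyshevTracialDesignLevelAttenuation

open Finset Literature.Combinatorics.AssociationSchemes Literature.Combinatorics.AssociationSchemes.JohnsonHarmonics
open Literature.Combinatorics.AssociationSchemes.JohnsonSpectrum
open Literature.Barriers.PneNP Literature.Combinatorics.SimpleGraph.CycleSpace
open Summit.PneNP.PneNP.Theorems.ChebyshevTracialDesignTightColumnSums
open Summit.PneNP.PneNP.Theorems.ChebyshevTracialDesignTightOddLayers
open Summit.PneNP.PneNP.Theorems.ChebyshevTracialDesignSaturatedSubsets
open Summit.PneNP.PneNP.Theorems.ChebyshevTracialDesignLevelColumnSums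
open Summit.PneNP.PneNP.Theorems.ChebyshevTracialDesignLevelDifference
open Summit.PneNP.PneNP.Theorems.ChebyshevTracialDesignLevelDominance
open Summit.PneNP.PneNP.Theorems.ChebyshevTracialDesignTightEvenProduct
open Summit.PneNP.PneNP.Theorems.ChebyshevTracialDesignTightEigenDecay
open Summit.PneNP.PneNP.Theorems.ChebyshevTracialDesignJunta

variable {n : ℕ}

/-! ### §1 Level classes of the `t`-sets: crossing count versus inner keys, and their size -/

/-- On the `(r + 2e)`-sets, "`r` crossing points" is the same as "`e` inner keys" (`|U| = #cr + 2·#inner keys`). -/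
theorem filter_cross_eq_filter_innerKeys (M : PMatch n) (r e : ℕ) :
    (powersetCard (r + 2 * e) (univ : Finset (Fin n))).filter
        (fun U => (U.filter fun x => M.2.partner x ∉ U).card = r) =
      (powersetCard (r + 2 * e) (univ : Finset (Fin n))).filter
        (fun U => (U.filter fun x => x < M.2.partner x ∧ M.2.partner x ∈ U).card = e) := by
  refine filter_congr fun U hU => ?_
  have hUc := (mem_powersetCard.1 hU).2
  have h1 := two_mul_card_innerKeys (partner_invol M).1 (partner_invol M).2 U
  have h2 := card_eq_unpaired_add_paired (π := M.2.partner) U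
  constructor <;> intro h <;> omega

/-- **Size of an odd level class**: `#{U : |U| = 2m+1+2e, #cr(U,M) = 2m+1} = T(n/2; 2m+1, e) = C(n/2, 2m+1+e)·C(2m+1+e, e)·2^{2m+1}`.
[cite: Rothvoss2017, §2 (PDF p. 6)] -/
theorem card_filter_cross_eq (M : PMatch n) (m e : ℕ) :
    ((powersetCard (2 * m + 1 + 2 * e) (univ : Finset (Fin n))).filter
        (fun U => (U.filter fun x => M.2.partner x ∉ U).card = 2 * m + 1)).card =
      (n / 2).choose (2 * m + 1 + e) * (2 * m + 1 + e).choose e * 2 ^ (2 * m + 1) := by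
  classical
  have hN : M.1.card = n / 2 := by have := two_mul_card_pmatch M; omega
  have hset : (powersetCard (2 * m + 1 + 2 * e) (univ : Finset (Fin n))).filter
        (fun U => (U.filter fun x => M.2.partner x ∉ U).card = 2 * m + 1) =
      (univ : Finset (Fin n)).powerset.filter (fun U =>
        (M.1.filter fun e' => cutCount U e' = 1).card = 2 * m + 1 ∧ (M.1.filter fun e' => cutCount U e' = 2).card = e) := by
    ext U
    simp only [mem_filter, mem_powersetCard, mem_powerset, subset_univ, true_and]
    have hcard := card_eq_cr_add_two_mul_in M.2 (subset_univ U)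
    constructor
    · rintro ⟨hUc, hr⟩
      have hodd : Odd U.card := ⟨m + e, by omega⟩
      have hcc : (U.filter fun x => M.2.partner x ∉ U).card = (M.1.filter fun e' => cutCount U e' = 1).card := by
        rw [← cc_eq_card_filter_partner ⟨U, hodd⟩ M, cc_eq_card_filter ⟨U, hodd⟩ M]
      rw [hcc] at hr
      exact ⟨hr, by omega⟩
    · rintro ⟨hr, he⟩
      have hUc : U.card = 2 * m + 1 + 2 * e := by omega
      have hodd : Odd U.card := ⟨m + e, by omega⟩
      have hcc : (U.filter fun x => M.2.partner x ∉ U).card = (M.1.filter fun e' => cutCount U e' = 1).card := by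
        rw [← cc_eq_card_filter_partner ⟨U, hodd⟩ M, cc_eq_card_filter ⟨U, hodd⟩ M]
      exact ⟨hUc, by rw [hcc]; exact hr⟩
  rw [hset, card_filter_cr_in_eq M.2 (2 * m + 1) e, hN]

/-- **Column sums of the level incidence** (the `d_C` of lit's §7): every perfect matching has exactly `T(n/2; r, e)` cuts of
size `t = r + 2e` at the odd level `r`. [cite: Rothvoss2017, §2 (PDF p. 6)] -/
theorem level_colSum_eq {t r e : ℕ} (hr : Odd r) (hre : r + 2 * e = t) (M : PMatch n) :
    ∑ U ∈ univ.powersetCard t, (if (U.filter fun x => M.2.partner x ∉ U).card = r then (1 : ℝ) else 0) =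
      (((n / 2).choose (r + e) * (r + e).choose e * 2 ^ r : ℕ) : ℝ) := by
  obtain ⟨m, rfl⟩ := hr
  subst hre
  rw [sum_boole]
  exact_mod_cast card_filter_cross_eq M m e

/-- **Row sums of a Gram class-function incidence are constant**: they are read off the Gram kernel on the diagonal,
`Σ_M A(U,M) = Σ_M A(U,M)² = κ(t)` for a `0/1` incidence. [cite: BrouwerHaemers2012, Prop. 4.3.2 (PDF p. 83)] -/
theorem level_rowSum_eq {t r : ℕ} (κ : ℕ → ℝ)
    (hA : ∀ U ∈ univ.powersetCard t, ∀ U' ∈ univ.powersetCard t,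
      ∑ M : PMatch n, (if (U.filter fun x => M.2.partner x ∉ U).card = r then (1 : ℝ) else 0) *
        (if (U'.filter fun x => M.2.partner x ∉ U').card = r then (1 : ℝ) else 0) = κ (U ∩ U').card)
    {U : Finset (Fin n)} (hU : U ∈ univ.powersetCard t) :
    ∑ M : PMatch n, (if (U.filter fun x => M.2.partner x ∉ U).card = r then (1 : ℝ) else 0) = κ t := by
  have h := hA U hU U hU
  rw [inter_self, (mem_powersetCard.1 hU).2] at h
  rw [← h]
  exact sum_congr rfl fun M _ => by split_ifs <;> simp

/-! ### §2 Column sums of a ladder test vector over a level class -/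

/-- The column sums of the ladder test vector `(Wᵀ)^{t−j} p` against the level-`r` incidence are `(t−j)!` times the `zeta`-sums
over the level class, written with inner keys (`t = r + 2e`). -/
theorem column_sum_ladder_level_eq {r e j : ℕ} (hjt : j ≤ r + 2 * e) {p : Finset (Fin n) → ℝ} (hp : IsHomog j p)
    (M : PMatch n) :
    ∑ U ∈ univ.powersetCard (r + 2 * e), (up^[r + 2 * e - j] p) U *
        (if (U.filter fun x => M.2.partner x ∉ U).card = r then (1 : ℝ) else 0) =
      ((r + 2 * e - j).factorial : ℝ) * ∑ U ∈ (powersetCard (r + 2 * e) (univ : Finset (Fin n))).filter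
        (fun U => (U.filter fun x => x < M.2.partner x ∧ M.2.partner x ∈ U).card = e), zeta p U := by
  rw [← filter_cross_eq_filter_innerKeys M r e, sum_filter, mul_sum]
  refine sum_congr rfl fun U hU => ?_
  rw [ladder_apply_eq_factorial_mul_zeta hjt hp (mem_powersetCard.1 hU).2]
  split_ifs <;> ring

/-! ### §3 Odd layers vanish; even layers are proportional to the tight kernel -/

/-- **Odd ladder eigenvalues of every level Gram kernel vanish.** For `t = 2c+1` with `2t ≤ n`, `j ≤ t` odd, `m ≤ c`, and `κ` the
Gram class function of the level-`(2m+1)` incidence on the `t`-sets: `kernelEigen n t j κ = 0`. [cite: Rothvoss2017, §2 (PDF p. 6)] -/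
theorem kernelEigen_level_eq_zero_of_odd {c m j : ℕ} (ht : 2 * (2 * c + 1) ≤ n) (hmc : m ≤ c) (hjt : j ≤ 2 * c + 1)
    (hj : Odd j) (κ : ℕ → ℝ)
    (hA : ∀ U ∈ univ.powersetCard (2 * c + 1), ∀ U' ∈ univ.powersetCard (2 * c + 1),
      ∑ M : PMatch n, (if (U.filter fun x => M.2.partner x ∉ U).card = 2 * m + 1 then (1 : ℝ) else 0) *
        (if (U'.filter fun x => M.2.partner x ∉ U').card = 2 * m + 1 then (1 : ℝ) else 0) = κ (U ∩ U').card) :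
    kernelEigen n (2 * c + 1) j κ = 0 := by
  obtain ⟨ha, hb, hab⟩ := standardDipoles_props (n := n) (j := j) (by omega)
  set a : Fin j → Fin n := fun i => ⟨2 * i.1, by omega⟩
  set b : Fin j → Fin n := fun i => ⟨2 * i.1 + 1, by omega⟩
  have hp := isHarmonic_dipoleVec ha hb hab
  have hgram := sum_sq_gram_ladder hjt
    (fun U (M : PMatch n) => if (U.filter fun x => M.2.partner x ∉ U).card = 2 * m + 1 then (1 : ℝ) else 0) κ hA hp
  have ht' : 2 * c + 1 = 2 * m + 1 + 2 * (c - m) := by omega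
  have hcol : ∀ M : PMatch n, ∑ U ∈ univ.powersetCard (2 * c + 1), (up^[2 * c + 1 - j] (dipoleVec j a b)) U *
      (if (U.filter fun x => M.2.partner x ∉ U).card = 2 * m + 1 then (1 : ℝ) else 0) = 0 := by
    intro M
    rw [ht', column_sum_ladder_level_eq (by omega) hp.1 M,
      show 2 * m + 1 + 2 * (c - m) = 2 * c + 1 by omega,
      level_column_sum_zeta_eq_zero_of_odd (partner_invol M).1 (partner_invol M).2 hj hp c (c - m), mul_zero]
  simp only [hcol] at hgram
  simp only [ne_eq, OfNat.ofNat_ne_zero, not_false_eq_true, zero_pow, sum_const_zero] at hgram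
  have hnorm : 0 < ip (up^[2 * c + 1 - j] (dipoleVec j a b)) (up^[2 * c + 1 - j] (dipoleVec j a b)) := by
    rw [ip_iterate_up_of_isHarmonic hp, ip_dipoleVec_self j a b ha hb hab]
    exact mul_pos (ladderProd_range_pos hjt (by omega)) (by positivity)
  rcases mul_eq_zero.1 hgram.symm with h | h
  · exact h
  · exact absurd h hnorm.ne'

/-- **Proportionality of the level kernels to the tight kernel, layer by layer.** For `t = 2c+1`, `2t ≤ n`, `κ' ≤ c`, `m ≤ c`,
with `κ₁` the Gram class function of the tight incidence and `κ_m` that of the level-`(2m+1)` incidence on the `t`-sets, and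
`σ̃(e₀)` the closed-form bi-mode coefficient of brick 10 at `e₀` inner edges:
`kernelEigen n t (2κ') κ_m · σ̃(c)² = kernelEigen n t (2κ') κ₁ · σ̃(c−m)²`. [cite: Rothvoss2017, §2 (PDF p. 6)] -/
theorem kernelEigen_level_mul_eq {c κ' m : ℕ} (ht : 2 * (2 * c + 1) ≤ n) (hκc : κ' ≤ c) (hmc : m ≤ c) (κ₁ κm : ℕ → ℝ)
    (hA1 : ∀ U ∈ univ.powersetCard (2 * c + 1), ∀ U' ∈ univ.powersetCard (2 * c + 1),
      ∑ M : PMatch n, (if (U.filter fun x => M.2.partner x ∉ U).card = 1 then (1 : ℝ) else 0) *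
        (if (U'.filter fun x => M.2.partner x ∉ U').card = 1 then (1 : ℝ) else 0) = κ₁ (U ∩ U').card)
    (hAm : ∀ U ∈ univ.powersetCard (2 * c + 1), ∀ U' ∈ univ.powersetCard (2 * c + 1),
      ∑ M : PMatch n, (if (U.filter fun x => M.2.partner x ∉ U).card = 2 * m + 1 then (1 : ℝ) else 0) *
        (if (U'.filter fun x => M.2.partner x ∉ U').card = 2 * m + 1 then (1 : ℝ) else 0) = κm (U ∩ U').card) :
    kernelEigen n (2 * c + 1) (2 * κ') κm *
        (∑ e' ∈ range (c - κ' + 1), if e' ≤ c then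
          (-1 : ℝ) ^ (κ' - (c - e')) * (κ'.choose (c - e') : ℝ) *
            (((n / 2 - 2 * κ').choose (2 * (c - κ') + 1 - 2 * e' + e') *
                (2 * (c - κ') + 1 - 2 * e' + e').choose e' * 2 ^ (2 * (c - κ') + 1 - 2 * e') : ℕ) : ℝ)
          else 0) ^ 2 =
      kernelEigen n (2 * c + 1) (2 * κ') κ₁ *
        (∑ e' ∈ range (c - κ' + 1), if e' ≤ c - m then
          (-1 : ℝ) ^ (κ' - (c - m - e')) * (κ'.choose (c - m - e') : ℝ) *
            (((n / 2 - 2 * κ').choose (2 * (c - κ') + 1 - 2 * e' + e') *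
                (2 * (c - κ') + 1 - 2 * e' + e').choose e' * 2 ^ (2 * (c - κ') + 1 - 2 * e') : ℕ) : ℝ)
          else 0) ^ 2 := by
  obtain ⟨ha, hb, hab⟩ := standardDipoles_props (n := n) (j := 2 * κ') (by omega)
  set a : Fin (2 * κ') → Fin n := fun i => ⟨2 * i.1, by omega⟩
  set b : Fin (2 * κ') → Fin n := fun i => ⟨2 * i.1 + 1, by omega⟩
  have hp := isHarmonic_dipoleVec ha hb hab
  have hjt : 2 * κ' ≤ 2 * c + 1 := by omega
  -- the two Gram identities `Σ_M (column sum)² = kernelEigen · ⟪φ, φ⟫`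
  have hgm := sum_sq_gram_ladder hjt
    (fun U (M : PMatch n) => if (U.filter fun x => M.2.partner x ∉ U).card = 2 * m + 1 then (1 : ℝ) else 0) κm hAm hp
  have hg1 := sum_sq_gram_ladder hjt
    (fun U (M : PMatch n) => if (U.filter fun x => M.2.partner x ∉ U).card = 1 then (1 : ℝ) else 0) κ₁ hA1 hp
  -- the column sums: `(t−2κ')! · σ̃(e₀) · Π_χ(M)` with `e₀ = c − m` resp. `e₀ = c`
  set Q : PMatch n → ℝ := fun M => ∑ T ∈ univ.filter
      (fun T : Finset (Fin n) => (T.filter fun x => M.2.partner x ∈ T).card = 2 * κ'), dipoleVec (2 * κ') a b T with hQ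
  set Sm : ℝ := ∑ e' ∈ range (c - κ' + 1), (if e' ≤ c - m then
      (-1 : ℝ) ^ (κ' - (c - m - e')) * (κ'.choose (c - m - e') : ℝ) *
        (((n / 2 - 2 * κ').choose (2 * (c - κ') + 1 - 2 * e' + e') *
            (2 * (c - κ') + 1 - 2 * e' + e').choose e' * 2 ^ (2 * (c - κ') + 1 - 2 * e') : ℕ) : ℝ)
      else 0) with hSm
  set S1 : ℝ := ∑ e' ∈ range (c - κ' + 1), (if e' ≤ c then
      (-1 : ℝ) ^ (κ' - (c - e')) * (κ'.choose (c - e') : ℝ) *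
        (((n / 2 - 2 * κ').choose (2 * (c - κ') + 1 - 2 * e' + e') *
            (2 * (c - κ') + 1 - 2 * e' + e').choose e' * 2 ^ (2 * (c - κ') + 1 - 2 * e') : ℕ) : ℝ)
      else 0) with hS1
  have hcolm : ∀ M : PMatch n, ∑ U ∈ univ.powersetCard (2 * c + 1), (up^[2 * c + 1 - 2 * κ'] (dipoleVec (2 * κ') a b)) U *
      (if (U.filter fun x => M.2.partner x ∉ U).card = 2 * m + 1 then (1 : ℝ) else 0) =
      ((2 * c + 1 - 2 * κ').factorial : ℝ) * (Sm * Q M) := by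
    intro M
    have ht' : 2 * c + 1 = 2 * m + 1 + 2 * (c - m) := by omega
    rw [ht', column_sum_ladder_level_eq (by omega) hp.1 M, show 2 * m + 1 + 2 * (c - m) = 2 * c + 1 by omega,
      level_column_sum_zeta_eq_difference (partner_invol M).1 (partner_invol M).2 hκc ht (hp := hp)]
  have hcol1 : ∀ M : PMatch n, ∑ U ∈ univ.powersetCard (2 * c + 1), (up^[2 * c + 1 - 2 * κ'] (dipoleVec (2 * κ') a b)) U *
      (if (U.filter fun x => M.2.partner x ∉ U).card = 1 then (1 : ℝ) else 0) =
      ((2 * c + 1 - 2 * κ').factorial : ℝ) * (S1 * Q M) := by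
    intro M
    have ht' : 2 * c + 1 = 1 + 2 * c := by ring
    rw [ht', column_sum_ladder_level_eq (by omega) hp.1 M, show 1 + 2 * c = 2 * c + 1 by ring,
      level_column_sum_zeta_eq_difference (partner_invol M).1 (partner_invol M).2 hκc ht (hp := hp)]
  simp only [hcolm] at hgm
  simp only [hcol1] at hg1
  -- `kernelEigen_m · I = F²·Sm²·ΣQ²`, `kernelEigen_1 · I = F²·S1²·ΣQ²`
  set I : ℝ := ip (up^[2 * c + 1 - 2 * κ'] (dipoleVec (2 * κ') a b)) (up^[2 * c + 1 - 2 * κ'] (dipoleVec (2 * κ') a b)) with hI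
  have hIpos : 0 < I := by
    rw [hI, ip_iterate_up_of_isHarmonic hp, ip_dipoleVec_self (2 * κ') a b ha hb hab]
    exact mul_pos (ladderProd_range_pos hjt (by omega)) (by positivity)
  have hsumm : ∑ M : PMatch n, (((2 * c + 1 - 2 * κ').factorial : ℝ) * (Sm * Q M)) ^ 2 =
      Sm ^ 2 * ∑ M : PMatch n, (((2 * c + 1 - 2 * κ').factorial : ℝ) * Q M) ^ 2 := by
    rw [mul_sum]; exact sum_congr rfl fun M _ => by ring
  have hsum1 : ∑ M : PMatch n, (((2 * c + 1 - 2 * κ').factorial : ℝ) * (S1 * Q M)) ^ 2 =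
      S1 ^ 2 * ∑ M : PMatch n, (((2 * c + 1 - 2 * κ').factorial : ℝ) * Q M) ^ 2 := by
    rw [mul_sum]; exact sum_congr rfl fun M _ => by ring
  rw [hsumm] at hgm
  rw [hsum1] at hg1
  -- cancel `I > 0`
  have key : (kernelEigen n (2 * c + 1) (2 * κ') κm * S1 ^ 2) * I = (kernelEigen n (2 * c + 1) (2 * κ') κ₁ * Sm ^ 2) * I := by
    calc (kernelEigen n (2 * c + 1) (2 * κ') κm * S1 ^ 2) * I
        = S1 ^ 2 * (kernelEigen n (2 * c + 1) (2 * κ') κm * I) := by ring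
      _ = S1 ^ 2 * (Sm ^ 2 * ∑ M : PMatch n, (((2 * c + 1 - 2 * κ').factorial : ℝ) * Q M) ^ 2) := by rw [hgm]
      _ = Sm ^ 2 * (S1 ^ 2 * ∑ M : PMatch n, (((2 * c + 1 - 2 * κ').factorial : ℝ) * Q M) ^ 2) := by ring
      _ = Sm ^ 2 * (kernelEigen n (2 * c + 1) (2 * κ') κ₁ * I) := by rw [hg1]
      _ = _ := by ring
  exact mul_right_cancel₀ hIpos.ne' key

/-! ### §4 (ATT) at every level and every even layer -/

/-- **Attenuation of every level kernel on every even layer.** For `n` even, `t = 2c+1`, `2t ≤ n`, `κ' ≤ c`, `m ≤ c`, with `κ₁`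
the Gram class function of the tight incidence and `κ_m` that of the level-`(2m+1)` incidence on the `t`-sets:
`kernelEigen n t (2κ') κ_m ≤ kernelEigen n t 0 κ_m · ((1+ρ)^{κ'})² · Π_{i<κ'} (2i+1)/(n−2i)` with
`ρ = 2m(2m+1)/(4(c−m+1)(n/2−c−m))`, i.e. `σ_{κ'}(2m+1)² ≤ (1+ρ)^{2κ'}·Π_{i<κ'}(2i+1)/(n−2i)` for the normalised singular values of
the level-`(2m+1)` relation between `t`-cuts and perfect matchings. [cite: Rothvoss2017, §2 (PDF p. 6)]
[cite: GodsilMeagher2015, §15.2 (perfect matching scheme)] -/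
theorem kernelEigen_level_le {c κ' m : ℕ} (hn : Even n) (ht : 2 * (2 * c + 1) ≤ n) (hκc : κ' ≤ c) (hmc : m ≤ c)
    (κ₁ κm : ℕ → ℝ)
    (hA1 : ∀ U ∈ univ.powersetCard (2 * c + 1), ∀ U' ∈ univ.powersetCard (2 * c + 1),
      ∑ M : PMatch n, (if (U.filter fun x => M.2.partner x ∉ U).card = 1 then (1 : ℝ) else 0) *
        (if (U'.filter fun x => M.2.partner x ∉ U').card = 1 then (1 : ℝ) else 0) = κ₁ (U ∩ U').card)
    (hAm : ∀ U ∈ univ.powersetCard (2 * c + 1), ∀ U' ∈ univ.powersetCard (2 * c + 1),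
      ∑ M : PMatch n, (if (U.filter fun x => M.2.partner x ∉ U).card = 2 * m + 1 then (1 : ℝ) else 0) *
        (if (U'.filter fun x => M.2.partner x ∉ U').card = 2 * m + 1 then (1 : ℝ) else 0) = κm (U ∩ U').card) :
    kernelEigen n (2 * c + 1) (2 * κ') κm ≤
      kernelEigen n (2 * c + 1) 0 κm *
        ((1 + (2 * m * (2 * m + 1) : ℝ) / (4 * (c - m + 1) * ((n / 2 - c - m : ℕ) : ℝ))) ^ κ') ^ 2 *
        ∏ i ∈ range κ', ((2 * i + 1 : ℝ) / ((n : ℝ) - 2 * i)) := by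
  classical
  have hcN : 2 * c + 1 ≤ n / 2 := by omega
  -- the four ingredients
  have hprop := kernelEigen_level_mul_eq ht hκc hmc κ₁ κm hA1 hAm
  have hdom := bimodeCoeff_sq_mul_le (n / 2) c κ' m hκc hmc hcN
  have htight := kernelEigen_tight_even_le_prod hn ht hκc κ₁ hA1
  have h1nn : 0 ≤ kernelEigen n (2 * c + 1) (2 * κ') κ₁ := kernelEigen_tight_even_nonneg hn ht hκc κ₁ hA1
  -- abbreviations
  set S1 : ℝ := ∑ e' ∈ range (c - κ' + 1), (if e' ≤ c then
      (-1 : ℝ) ^ (κ' - (c - e')) * (κ'.choose (c - e') : ℝ) *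
        (((n / 2 - 2 * κ').choose (2 * (c - κ') + 1 - 2 * e' + e') *
            (2 * (c - κ') + 1 - 2 * e' + e').choose e' * 2 ^ (2 * (c - κ') + 1 - 2 * e') : ℕ) : ℝ)
      else 0) with hS1
  set Sm : ℝ := ∑ e' ∈ range (c - κ' + 1), (if e' ≤ c - m then
      (-1 : ℝ) ^ (κ' - (c - m - e')) * (κ'.choose (c - m - e') : ℝ) *
        (((n / 2 - 2 * κ').choose (2 * (c - κ') + 1 - 2 * e' + e') *
            (2 * (c - κ') + 1 - 2 * e' + e').choose e' * 2 ^ (2 * (c - κ') + 1 - 2 * e') : ℕ) : ℝ)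
      else 0) with hSm
  set R0 : ℝ := (((n / 2 - 2 * κ').choose (1 + (c - κ')) * (1 + (c - κ')).choose (c - κ') * 2 ^ 1 : ℕ) : ℝ) with hR0
  set U0 : ℝ := (((n / 2).choose (1 + c) * (1 + c).choose c * 2 ^ 1 : ℕ) : ℝ) with hU0
  set Um : ℝ := (((n / 2).choose (2 * m + 1 + (c - m)) * (2 * m + 1 + (c - m)).choose (c - m) * 2 ^ (2 * m + 1) : ℕ) : ℝ)
    with hUm
  set B : ℝ := (1 + (2 * m * (2 * m + 1) : ℝ) / (4 * (c - m + 1) * ((n / 2 - c - m : ℕ) : ℝ))) ^ κ' with hB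
  set P : ℝ := ∏ i ∈ range κ', ((2 * i + 1 : ℝ) / ((n : ℝ) - 2 * i)) with hP
  -- the tight coefficient `S1` is the single surviving term `R0 > 0`
  have hS1R0 : S1 = R0 := by
    rw [hS1, sum_eq_single_of_mem (c - κ') (mem_range.2 (by omega))]
    · rw [if_pos (Nat.sub_le c κ'), show c - (c - κ') = κ' by omega, Nat.sub_self, pow_zero, Nat.choose_self, Nat.cast_one,
        one_mul, one_mul, show 2 * (c - κ') + 1 - 2 * (c - κ') = 1 by omega, hR0, show 1 + (c - κ') = 1 + (c - κ') from rfl]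
    · intro e' he' hne
      have he'c : e' < c - κ' := by have := mem_range.1 he'; omega
      rw [if_pos (by omega), Nat.choose_eq_zero_of_lt (by omega : κ' < c - e')]; simp
  have hR0pos : 0 < R0 := by
    rw [hR0]; push_cast
    have h1 : 0 < (((n / 2 - 2 * κ').choose (1 + (c - κ')) : ℕ) : ℝ) := by exact_mod_cast Nat.choose_pos (by omega)
    have h2 : 0 < (((1 + (c - κ')).choose (c - κ') : ℕ) : ℝ) := by exact_mod_cast Nat.choose_pos (by omega)
    positivity
  have hU0pos : 0 < U0 := by
    rw [hU0]; push_cast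
    have h1 : 0 < (((n / 2).choose (1 + c) : ℕ) : ℝ) := by exact_mod_cast Nat.choose_pos (by omega)
    have h2 : 0 < (((1 + c).choose c : ℕ) : ℝ) := by exact_mod_cast Nat.choose_pos (by omega)
    positivity
  -- column and row sums, `λ₀ = d_R d_C`, handshake
  have hcolm : ∀ M : PMatch n, ∑ U ∈ univ.powersetCard (2 * c + 1),
      (if (U.filter fun x => M.2.partner x ∉ U).card = 2 * m + 1 then (1 : ℝ) else 0) = Um :=
    fun M => level_colSum_eq ⟨m, rfl⟩ (by omega) M
  have hcol1 : ∀ M : PMatch n, ∑ U ∈ univ.powersetCard (2 * c + 1),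
      (if (U.filter fun x => M.2.partner x ∉ U).card = 1 then (1 : ℝ) else 0) = U0 :=
    fun M => level_colSum_eq ⟨0, rfl⟩ (by omega) M
  obtain ⟨U₁, hU₁⟩ : ∃ U : Finset (Fin n), U ∈ univ.powersetCard (2 * c + 1) := by
    have : (univ.powersetCard (2 * c + 1) : Finset (Finset (Fin n))).Nonempty := by
      apply powersetCard_nonempty.2; rw [card_univ, Fintype.card_fin]; omega
    exact this
  have hU₁t : U₁.card = 2 * c + 1 := (mem_powersetCard.1 hU₁).2
  have hrowm := fun U hU => level_rowSum_eq (t := 2 * c + 1) (r := 2 * m + 1) κm hAm (U := U) hU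
  have hrow1 := fun U hU => level_rowSum_eq (t := 2 * c + 1) (r := 1) κ₁ hA1 (U := U) hU
  have hl0m := kernelEigen_zero_eq_rowSum_mul_colSum _ κm hAm hcolm hU₁t (hrowm U₁ hU₁)
  have hl01 := kernelEigen_zero_eq_rowSum_mul_colSum _ κ₁ hA1 hcol1 hU₁t (hrow1 U₁ hU₁)
  have hhm := choose_mul_rowSum_eq_card_mul_colSum _ hcolm hrowm
  have hh1 := choose_mul_rowSum_eq_card_mul_colSum _ hcol1 hrow1
  -- assemble: `λ_m · S1² · U0² ≤ λ₁ · B² · S1² · Um² ≤ λ₀(κ₁)·P·B²·S1²·Um²` and `λ₀(κ₁)·Um² = λ₀(κ_m)·U0²`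
  have hCnt : 0 < (n.choose (2 * c + 1) : ℝ) := by exact_mod_cast Nat.choose_pos (by omega)
  have step1 : kernelEigen n (2 * c + 1) (2 * κ') κm * S1 ^ 2 * U0 ^ 2 ≤
      kernelEigen n (2 * c + 1) (2 * κ') κ₁ * (B ^ 2 * S1 ^ 2 * Um ^ 2) := by
    rw [hprop, mul_assoc]
    refine mul_le_mul_of_nonneg_left ?_ h1nn
    rw [hS1R0]
    calc Sm ^ 2 * U0 ^ 2 ≤ B ^ 2 * R0 ^ 2 * Um ^ 2 := hdom
      _ = _ := by ring
  have step2 : kernelEigen n (2 * c + 1) (2 * κ') κ₁ * (B ^ 2 * S1 ^ 2 * Um ^ 2) ≤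
      kernelEigen n (2 * c + 1) 0 κ₁ * P * (B ^ 2 * S1 ^ 2 * Um ^ 2) :=
    mul_le_mul_of_nonneg_right htight (by positivity)
  -- `λ₀(κ₁) · Um² = λ₀(κ_m) · U0²` (both equal `|PM| · U0² · Um² / C(n,t)`)
  have hswap : kernelEigen n (2 * c + 1) 0 κ₁ * Um ^ 2 = kernelEigen n (2 * c + 1) 0 κm * U0 ^ 2 := by
    have e1 : kernelEigen n (2 * c + 1) 0 κ₁ * Um ^ 2 * (n.choose (2 * c + 1) : ℝ) =
        (Fintype.card (PMatch n) : ℝ) * U0 ^ 2 * Um ^ 2 := by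
      rw [hl01]
      calc κ₁ (2 * c + 1) * U0 * Um ^ 2 * (n.choose (2 * c + 1) : ℝ)
          = ((n.choose (2 * c + 1) : ℝ) * κ₁ (2 * c + 1)) * U0 * Um ^ 2 := by ring
        _ = _ := by rw [hh1]; ring
    have e2 : kernelEigen n (2 * c + 1) 0 κm * U0 ^ 2 * (n.choose (2 * c + 1) : ℝ) =
        (Fintype.card (PMatch n) : ℝ) * U0 ^ 2 * Um ^ 2 := by
      rw [hl0m]
      calc κm (2 * c + 1) * Um * U0 ^ 2 * (n.choose (2 * c + 1) : ℝ)
          = ((n.choose (2 * c + 1) : ℝ) * κm (2 * c + 1)) * Um * U0 ^ 2 := by ring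
        _ = _ := by rw [hhm]; ring
    exact mul_right_cancel₀ hCnt.ne' (e1.trans e2.symm)
  have step3 : kernelEigen n (2 * c + 1) 0 κ₁ * P * (B ^ 2 * S1 ^ 2 * Um ^ 2) =
      (kernelEigen n (2 * c + 1) 0 κm * B ^ 2 * P) * (S1 ^ 2 * U0 ^ 2) := by
    calc kernelEigen n (2 * c + 1) 0 κ₁ * P * (B ^ 2 * S1 ^ 2 * Um ^ 2)
        = (kernelEigen n (2 * c + 1) 0 κ₁ * Um ^ 2) * (P * B ^ 2 * S1 ^ 2) := by ring
      _ = (kernelEigen n (2 * c + 1) 0 κm * U0 ^ 2) * (P * B ^ 2 * S1 ^ 2) := by rw [hswap]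
      _ = _ := by ring
  have hpos : 0 < S1 ^ 2 * U0 ^ 2 := by rw [hS1R0]; positivity
  have := (step1.trans step2).trans_eq step3
  rw [show kernelEigen n (2 * c + 1) (2 * κ') κm * S1 ^ 2 * U0 ^ 2 =
      kernelEigen n (2 * c + 1) (2 * κ') κm * (S1 ^ 2 * U0 ^ 2) by ring] at this
  exact le_of_mul_le_mul_right this hpos

end Summit.PneNP.PneNP.Theorems.ChebyshevTracialDesignLevelAttenuation
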